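import Literature.MathematicalPhysics.QuantumFieldTheory.Balaban1983to89.B9WalkLettersCoordsLeib
import Literature.MathematicalPhysics.QuantumFieldTheory.Balaban1983to89.B9SiteKernelBlockMajorant
import Literature.MathematicalPhysics.QuantumFieldTheory.Balaban1983to89.Node00.OpsYLeibnizLettersSizes

/-!
# `Balaban1983to89.B9WalkLettersCoordsDom` — W-a FILE C-2 (part 2a): the rows-18 K-LETTERS and LEIBNIZ LETTERS of the walk (3.87)–(3.90), as COORDINATE MODELS
# on dag-n06-d's site carrier (`B9WalkLettersCoordsLeib`), are DOMINATED BY BLOCK KERNELS read off their STENCIL SIZES (node00-def-Y FILE 38) — the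
# `Identities₂.hP ∕ hPt ∕ hC ∕ hCt ∕ hCD ∕ hCL ∕ hCLt ∕ hPL` clauses of the N06 certificate at the models, with the block kernel left as a displayed majorant

statement-level skeleton of published theorems with citation tags; proofs where landed; nothing here is a claim about the Yang–Mills mass gap

B9 = T. Bałaban, *Propagators for lattice gauge theories in a background field*, Commun. Math. Phys. **99** (1985) 389–434 [Balaban1985BackgroundPropagators];
[4] = T. Bałaban, *Propagators and renormalization transformations for lattice gauge theories. II*, Commun. Math. Phys. **96** (1984) 223–250 [Balaban1984PropagatorsII].
THE PRINT.  (3.88)–(3.89) p.409: `K(h_□) = Σ_b (∂h_□)(b)(D_U·)(b) + (Δh_□)· + (averaging line)`, «a semi-local operator of size O(M⁻¹)»; (3.100) p.413 (the Leibniz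
rules of `∇_U`, `Δ_U` through `M_h`); [4] (2.39)–(2.40) pp.229–230, (2.51) p.232 (the block-majorant currency «|(Tλ)(x)| ≤ K(y, y′)|λ|, x ∈ Δ(y), supp λ ⊂ Δ(y′)»).
WHY THIS FILE (pub-ymgap, dag-n06-d W-a C-2 programme, HOME `W-a-C2-PLAN.md` §4 PART 2; node00-def-Y `W-a-DESIGN.md` §1–§2).  The N06 certificate displays the
rows-18 walk letters `𝔬 𝔡 𝔩` with their static data and the schema `h36 : … → Local342 … ∧ Identities₂ (𝔬 x) (𝔡 x) (𝔩 x) 1 (H x) U`; `Identities₂` asks, letter by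
letter, for a block majorant (`hP : ∀ i μ, HasMajorant blk (𝔩.P U i μ) (𝔩.KPd i μ)`, `hC`, `hPt`, `hCt`, `hCD`, `hCL`, `hCLt`, `hPL` (+ `hPD` for the ZERO letter
`PD := 0` of FILE C-2 part 1)).  Part 1 (`B9WalkLettersCoordsLeib`, p652725) gave the letters as coordinate models `pcoS ptcoS plcoS ccoS ctcoS clcoS cdcoS cltcoS`
(and the six identity clauses); node00-def-Y FILE 38 (`Node00.OpsYLeibnizLettersSizes`) gave each 𝔸-level letter's POINTWISE STENCIL SIZE for contraction-pair
transporters; dag-n06-l's engine `B9SiteKernelBlockMajorant.hasMajorant_coordOpK_of_kernel` turns a FIBRE KERNEL bound `‖T ν (δ_w ⊗ a)(z)‖ ≤ K₀(z,w)‖a‖` of a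
family into the block majorant of its coordinate model.  This file composes the three:
* §1 `hasMajorant_smul_nonneg ∕ hasMajorant_neg'` (scalars and signs keep majorants; two lines each), `norm_deltaY_apply` (`‖(δ_w ⊗ a)(z)‖ = 𝟙[z = w]‖a‖`),
  `sum_filter_ite_eq` (the input-block sum of a point mass: `Σ_{w : σ w = y′} 𝟙[u = w]·t = 𝟙[σ u = y′]·t`);
* §2 THE FIBRE KERNELS of the seven 𝔸-level letters at a point mass (FILE 38 §2 at `Λ := δ_w ⊗ a`): `norm_pKY_deltaY_le` (`≤ (|∂⁺_μh z|𝟙[z=w] + |∂⁻̃_μh z|𝟙[z−e_μ=w])‖a‖`),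
  `norm_ptKY_deltaY_le`, `norm_cltY_deltaY_le`, `norm_cKY_deltaY_le` (`≤ (|Δh z|𝟙[z=w] + |avgCoeffY z w||h z − h w|)‖a‖`), `norm_ctKY_deltaY_le`,
  `norm_cdLetter_deltaY_le` (`M_{∂⁺_νh}∘S_ν`), `norm_clLetter_deltaY_le` (`M_{Δh}`);
* §3 ★★ THE DOMINATIONS of the eight models on the carrier with block map `p ↦ σ p.1` (any site block map `σ`, any geometry), each by a displayed kernel `K`
  bounding `coordBound·basisBound ×` the input-block sum of the fibre kernel, scaled by the model's prefactor (`(η·c_R)⁻¹`, `(η²·c_R)⁻¹`, `η⁻¹`, `η⁻²`):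
  `hasMajorant_pcoS ∕ _ptcoS ∕ _plcoS ∕ _ccoS ∕ _ctcoS ∕ _clcoS ∕ _cdcoS ∕ _cltcoS`.  The located block kernels (indicator of `S′_□` × block distance ≤ 1 × the
  Lipschitz sizes of `h_□`) and their row∕column sums (`StaticOK`, `Sizes.Bounded` — print's `O(M⁻¹)`) are PART 2b; the record `opsWalkY` and the assembled
  `Identities₂` are PART 3.
HONEST SCOPE.  Finite sums, the triangle inequality and two landed engines; the contraction-pair hypotheses on the bond variables `UboxY` and the averaging
transporters `avgTrY` are DISPLAYED (print: `U(b) ∈ G ⊂ U(N)`); no located number, no (3.42), no regime; nothing of [B9]'s analysis asserted; count-neutral; N06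
NOT discharged; nothing continuum ∕ OS ∕ mass gap ∕ Clay.  Cell `pub-ymgap` (D-0062), node N06 [B9], rows 18, seat `pub-ymgap-dag-n06-d` (gen 14).  Net new unproved facts: 0.
-/

noncomputable section

namespace Literature.MathematicalPhysics.QuantumFieldTheory.Balaban1983to89.B9WalkLettersCoordsDom

open Node00
open Node00.OpsYLeibnizLetters (fdiffY bdiffY lapDiffY fshiftSL fshiftSL_apply cltY pKY cKY ptKY ctKY)
open Node00.OpsYLeibnizLettersSizes (norm_cutMulY_apply norm_pKY_apply_le norm_ptKY_apply_le norm_cltY_apply_le norm_cKY_apply_le norm_ctKY_apply_le)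
open B6RandomWalk (HasMajorant)
open B6KLevelCensusIndexV1 (KIdx)
open B9Ineq349SiteComposite (etaS_pos)
open B9Thm37CubeCoverCommutators (cutMulY cutMulY_apply)
open B9Thm37CubeCoverCommutatorSizes (norm_R_le_of_pair norm_ofReal_smul)
open B9Thm39ReadingCoords (cR39 cR39_nonneg coordBound39 basisBound39)
open B9CoReadingCoords (coordOpK)
open B9CoReadingCoordsS (XSK)
open B9SiteKernelBlockMajorant (hasMajorant_coordOpK_of_kernel)
open B9WalkLettersCoordsLeib (pcoS ptcoS plcoS ccoS ctcoS clcoS cdcoS cltcoS)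

variable {𝔸 : Type} [NormedRing 𝔸] [NormedAlgebra ℂ 𝔸] [CompleteSpace 𝔸]
variable {κ : Type} [Fintype κ] [DecidableEq κ]
variable {d ℓ : ℕ} {hd : 1 ≤ d + 1} {hL : Odd (ℓ + 1) ∧ 1 < ℓ + 1} {b₀ b₁ : ℝ}
variable (i : KIdx d ℓ hd hL b₀ b₁) (b : Module.Basis κ ℝ 𝔸) (B : B9.Backgrounds) (cfg : B.Cfg → CfgY 𝔸 i) (parS : SiteParY 𝔸 i)

/-! ## §1 Bookkeeping -/

section Book

variable {S : Type} {g : B6.Geometry}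

omit [NormedAlgebra ℂ 𝔸] [CompleteSpace 𝔸] in
/-- a non-negative multiple scales a block majorant. [cite: Balaban1984PropagatorsII, (2.51) p.232, bookkeeping] -/
theorem hasMajorant_smul_nonneg (blk : S → g.Site) {T : Module.End ℝ (S → ℝ)} {K : g.Site → g.Site → ℝ} (h : HasMajorant (g := g) blk T K)
    {r : ℝ} (hr : 0 ≤ r) : HasMajorant (g := g) blk (r • T) (fun a a' => r * K a a') := by
  intro y' μ Bd hμ x
  rw [LinearMap.smul_apply, Pi.smul_apply, smul_eq_mul, abs_mul, abs_of_nonneg hr, mul_assoc]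
  exact mul_le_mul_of_nonneg_left (h y' μ Bd hμ x) hr

omit [NormedAlgebra ℂ 𝔸] [CompleteSpace 𝔸] in
/-- a negation keeps a block majorant. [cite: Balaban1984PropagatorsII, (2.51) p.232, bookkeeping] -/
theorem hasMajorant_neg' (blk : S → g.Site) {T : Module.End ℝ (S → ℝ)} {K : g.Site → g.Site → ℝ} (h : HasMajorant (g := g) blk T K) :
    HasMajorant (g := g) blk (-T) K := by
  intro y' μ Bd hμ x
  rw [LinearMap.neg_apply, Pi.neg_apply, abs_neg]
  exact h y' μ Bd hμ x

omit [NormedAlgebra ℂ 𝔸] [CompleteSpace 𝔸] in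
/-- the point mass, evaluated in norm: `‖(δ_w ⊗ a)(z)‖ = 𝟙[z = w]·‖a‖`. [cite: Balaban1984PropagatorsII, (2.51) p.232 («supp λ ⊂ Δ(y′)»), bookkeeping] -/
theorem norm_deltaY_apply {X : Type} [DecidableEq X] (w : X) (a : 𝔸) (z : X) : ‖deltaY w a z‖ = (if z = w then (1 : ℝ) else 0) * ‖a‖ := by
  unfold deltaY
  split_ifs <;> simp

/-- the input-block sum of a point mass: `Σ_{w : σ w = y′} 𝟙[u = w]·t = 𝟙[σ u = y′]·t`. [cite: Balaban1984PropagatorsII, (2.51) p.232, bookkeeping] -/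
theorem sum_filter_ite_eq {X : Type} [Fintype X] [DecidableEq X] [DecidableEq g.Site] (σ : X → g.Site) (y' : g.Site) (u : X) (t : ℝ) :
    (∑ w ∈ Finset.univ.filter (fun w => σ w = y'), (if u = w then (1 : ℝ) else 0) * t) = (if σ u = y' then (1 : ℝ) else 0) * t := by
  rw [← Finset.sum_mul]
  congr 1
  rw [Finset.sum_ite_eq]
  simp only [Finset.mem_filter, Finset.mem_univ, true_and]

/-- the input-block sum of a point mass (factor first): `Σ_{w : σ w = y′} t·𝟙[u = w] = t·𝟙[σ u = y′]`. [cite: Balaban1984PropagatorsII, (2.51) p.232, bookkeeping] -/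
theorem sum_filter_mul_ite {X : Type} [Fintype X] [DecidableEq X] [DecidableEq g.Site] (σ : X → g.Site) (y' : g.Site) (u : X) (t : ℝ) :
    (∑ w ∈ Finset.univ.filter (fun w => σ w = y'), t * (if u = w then (1 : ℝ) else 0)) = t * (if σ u = y' then (1 : ℝ) else 0) := by
  rw [← Finset.mul_sum, Finset.sum_ite_eq]
  simp only [Finset.mem_filter, Finset.mem_univ, true_and]

end Book

/-! ## §2 The fibre kernels of the 𝔸-level letters at a point mass -/

section Fibre

variable (U : CfgY 𝔸 i) (h : SiteY i → ℝ)

omit [NormedAlgebra ℂ 𝔸] [CompleteSpace 𝔸] in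
/-- the averaging line at a point mass keeps only its `w`-term. [cite: Balaban1984PropagatorsII, (2.39)–(2.40) pp.229–230, bookkeeping] -/
theorem sum_avg_deltaY (z w : SiteY i) (a : 𝔸) :
    (∑ w', |avgCoeffY i z w'| * |h z - h w'| * ‖deltaY w a w'‖) = |avgCoeffY i z w| * |h z - h w| * ‖a‖ := by
  rw [Finset.sum_eq_single w]
  · rw [norm_deltaY_apply, if_pos rfl, one_mul]
  · intro w' _ hw'; rw [norm_deltaY_apply, if_neg hw', zero_mul, mul_zero]
  · intro hw; exact absurd (Finset.mem_univ w) hw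

/-- ★ `‖(P_μ(δ_w ⊗ a))(z)‖ ≤ (|∂⁺_μh z|·𝟙[z = w] + |∂⁻̃_μh z|·𝟙[z − e_μ = w])·‖a‖`. [cite: Balaban1985BackgroundPropagators, (3.88)–(3.89) p.409; Balaban1984PropagatorsII, (2.40) p.230] -/
theorem norm_pKY_deltaY_le (μ : Fin (d + 1)) (hU : ∀ w : SiteY i, ‖(UboxY i U μ w : 𝔸)‖ ≤ 1 ∧ ‖(((UboxY i U μ w)⁻¹ : 𝔸ˣ) : 𝔸)‖ ≤ 1)
    (z w : SiteY i) (a : 𝔸) :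
    ‖pKY i U h μ (deltaY w a) z‖ ≤
      (|fdiffY i h μ z| * (if z = w then (1 : ℝ) else 0) + |bdiffY i h μ z| * (if (shiftY i μ).symm z = w then (1 : ℝ) else 0)) * ‖a‖ := by
  refine (norm_pKY_apply_le i U h μ (deltaY w a) z hU).trans (le_of_eq ?_)
  rw [norm_deltaY_apply, norm_deltaY_apply]; ring

/-- ★ `‖(Pt_μ(δ_w ⊗ a))(z)‖ ≤ |∂⁺_μh z|·(𝟙[z + e_μ = w] + 𝟙[z = w])·‖a‖`. [cite: Balaban1985BackgroundPropagators, (3.88)–(3.89) p.409; Balaban1984PropagatorsII, (2.40) p.230] -/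
theorem norm_ptKY_deltaY_le (μ : Fin (d + 1)) (hU : ∀ w : SiteY i, ‖(UboxY i U μ w : 𝔸)‖ ≤ 1 ∧ ‖(((UboxY i U μ w)⁻¹ : 𝔸ˣ) : 𝔸)‖ ≤ 1)
    (z w : SiteY i) (a : 𝔸) :
    ‖ptKY i U h μ (deltaY w a) z‖ ≤
      (|fdiffY i h μ z| * ((if shiftY i μ z = w then (1 : ℝ) else 0) + (if z = w then (1 : ℝ) else 0))) * ‖a‖ := by
  refine (norm_ptKY_apply_le i U h μ (deltaY w a) z hU).trans (le_of_eq ?_)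
  rw [norm_deltaY_apply, norm_deltaY_apply]; ring

/-- ★ `‖(C^{Lt}_μ(δ_w ⊗ a))(z)‖ ≤ |∂⁻̃_μh z|·𝟙[z − e_μ = w]·‖a‖`. [cite: Balaban1985BackgroundPropagators, (3.100) p.413] -/
theorem norm_cltY_deltaY_le (μ : Fin (d + 1)) (hU : ∀ w : SiteY i, ‖(UboxY i U μ w : 𝔸)‖ ≤ 1 ∧ ‖(((UboxY i U μ w)⁻¹ : 𝔸ˣ) : 𝔸)‖ ≤ 1)
    (z w : SiteY i) (a : 𝔸) :
    ‖cltY i U h μ (deltaY w a) z‖ ≤ (|bdiffY i h μ z| * (if (shiftY i μ).symm z = w then (1 : ℝ) else 0)) * ‖a‖ := by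
  refine (norm_cltY_apply_le i U h μ (deltaY w a) z hU).trans (le_of_eq ?_)
  rw [norm_deltaY_apply]; ring

/-- ★ `‖(C(δ_w ⊗ a))(z)‖ ≤ (|Δh z|·𝟙[z = w] + |avgCoeffY z w|·|h z − h w|)·‖a‖` (the averaging line contributes only its `w`-term).
[cite: Balaban1985BackgroundPropagators, (3.88)–(3.89) p.409; Balaban1984PropagatorsII, (2.39)–(2.40) pp.229–230] -/
theorem norm_cKY_deltaY_le (z : SiteY i) (hT : ∀ w : SiteY i, ‖(avgTrY i parS U z w : 𝔸)‖ ≤ 1 ∧ ‖(((avgTrY i parS U z w)⁻¹ : 𝔸ˣ) : 𝔸)‖ ≤ 1)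
    (w : SiteY i) (a : 𝔸) :
    ‖cKY i parS h U (deltaY w a) z‖ ≤ (|lapDiffY i h z| * (if z = w then (1 : ℝ) else 0) + |avgCoeffY i z w| * |h z - h w|) * ‖a‖ := by
  refine (norm_cKY_apply_le i parS h U (deltaY w a) z hT).trans (le_of_eq ?_)
  rw [sum_avg_deltaY i h z w a, norm_deltaY_apply]; ring

/-- ★ `‖(Cᵗ(δ_w ⊗ a))(z)‖ ≤ (|Δh z|·𝟙[z = w] + |avgCoeffY z w|·|h z − h w|)·‖a‖`. [cite: Balaban1985BackgroundPropagators, (3.88)–(3.89) p.409] -/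
theorem norm_ctKY_deltaY_le (z : SiteY i) (hT : ∀ w : SiteY i, ‖(avgTrY i parS U z w : 𝔸)‖ ≤ 1 ∧ ‖(((avgTrY i parS U z w)⁻¹ : 𝔸ˣ) : 𝔸)‖ ≤ 1)
    (w : SiteY i) (a : 𝔸) :
    ‖ctKY i parS h U (deltaY w a) z‖ ≤ (|lapDiffY i h z| * (if z = w then (1 : ℝ) else 0) + |avgCoeffY i z w| * |h z - h w|) * ‖a‖ := by
  refine (norm_ctKY_apply_le i parS h U (deltaY w a) z hT).trans (le_of_eq ?_)
  rw [sum_avg_deltaY i h z w a, norm_deltaY_apply]; ring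

/-- ★ the `leibD` letter on slice `ν`: `‖(M_{∂⁺_νh} S_ν (δ_w ⊗ a))(z)‖ ≤ |∂⁺_νh z|·𝟙[z + e_ν = w]·‖a‖`. [cite: Balaban1985BackgroundPropagators, (3.100) p.413] -/
theorem norm_cdLetter_deltaY_le (ν : Fin (d + 1)) (hU : ∀ w : SiteY i, ‖(UboxY i U ν w : 𝔸)‖ ≤ 1 ∧ ‖(((UboxY i U ν w)⁻¹ : 𝔸ˣ) : 𝔸)‖ ≤ 1)
    (z w : SiteY i) (a : 𝔸) :
    ‖(cutMulY (fdiffY i h ν) * fshiftSL i U ν : Module.End ℂ (SiteY i → 𝔸)) (deltaY w a) z‖ ≤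
      (|fdiffY i h ν z| * (if shiftY i ν z = w then (1 : ℝ) else 0)) * ‖a‖ := by
  rw [Module.End.mul_apply, norm_cutMulY_apply, fshiftSL_apply, mul_assoc, ← norm_deltaY_apply w a (shiftY i ν z)]
  exact mul_le_mul_of_nonneg_left (norm_R_le_of_pair _ (hU z).1 (hU z).2 _) (abs_nonneg _)

omit [CompleteSpace 𝔸] in
/-- ★ the `leibL` letter `M_{Δh}`: `‖(M_{Δh}(δ_w ⊗ a))(z)‖ = |Δh z|·𝟙[z = w]·‖a‖`. [cite: Balaban1985BackgroundPropagators, (3.100) p.413] -/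
theorem norm_clLetter_deltaY_le (z w : SiteY i) (a : 𝔸) :
    ‖cutMulY (𝔸 := 𝔸) (lapDiffY i h) (deltaY w a) z‖ ≤ (|lapDiffY i h z| * (if z = w then (1 : ℝ) else 0)) * ‖a‖ := by
  rw [norm_cutMulY_apply, norm_deltaY_apply, mul_assoc]

end Fibre

/-! ## §3 The dominations of the eight coordinate models by displayed block kernels -/

section Dom

variable [FiniteDimensional ℝ 𝔸]
variable {g : B6.Geometry} [DecidableEq g.Site] (σ : SiteY i → g.Site) (U₁ : B.Cfg) (h : SiteY i → ℝ)

omit [DecidableEq κ] in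
/-- ★★ **`P_□,μ` (`pcoS`) IS DOMINATED**: if `coordBound·basisBound·(|∂⁺_μh z|·𝟙[σ z = y′] + |∂⁻̃_μh z|·𝟙[σ(z − e_μ) = y′]) ≤ K(σ z, y′)` then `pcoS` has the block majorant
`(η·c_R)⁻¹·K` on `p ↦ σ p.1`. [cite: Balaban1985BackgroundPropagators, (3.88)–(3.89) p.409; Balaban1984PropagatorsII, (2.40) p.230, (2.51) p.232] -/
theorem hasMajorant_pcoS (μ : Fin (d + 1))
    (hU : ∀ w : SiteY i, ‖(UboxY i (cfg U₁) μ w : 𝔸)‖ ≤ 1 ∧ ‖(((UboxY i (cfg U₁) μ w)⁻¹ : 𝔸ˣ) : 𝔸)‖ ≤ 1) {K : g.Site → g.Site → ℝ}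
    (hK : ∀ (z : SiteY i) (y' : g.Site), coordBound39 b * basisBound39 b *
      (|fdiffY i h μ z| * (if σ z = y' then (1 : ℝ) else 0) + |bdiffY i h μ z| * (if σ ((shiftY i μ).symm z) = y' then (1 : ℝ) else 0)) ≤ K (σ z) y') :
    HasMajorant (g := g) (fun p : XSK κ i => σ p.1) (pcoS i b B cfg U₁ h μ) (fun a y' => (etaS i * cR39 b)⁻¹ * K a y') := by
  unfold pcoS
  refine hasMajorant_smul_nonneg _ (hasMajorant_coordOpK_of_kernel b σ _
    (fun z w => |fdiffY i h μ z| * (if z = w then (1 : ℝ) else 0) + |bdiffY i h μ z| * (if (shiftY i μ).symm z = w then (1 : ℝ) else 0))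
    (fun _ z w a => norm_pKY_deltaY_le i (cfg U₁) h μ hU z w a) (fun z w => by positivity) (fun z y' => ?_))
    (inv_nonneg.2 (mul_nonneg (etaS_pos i).le (cR39_nonneg b)))
  rw [Finset.sum_add_distrib, sum_filter_mul_ite, sum_filter_mul_ite]; exact hK z y'

omit [DecidableEq κ] in
/-- ★★ **`Pᵗ_□,μ` (`ptcoS`) IS DOMINATED**: `coordBound·basisBound·|∂⁺_μh z|·(𝟙[σ(z + e_μ) = y′] + 𝟙[σ z = y′]) ≤ K(σ z, y′)` ⟹ majorant `(η·c_R)⁻¹·K`.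
[cite: Balaban1985BackgroundPropagators, (3.88)–(3.89) p.409; Balaban1984PropagatorsII, (2.40) p.230, (2.51) p.232] -/
theorem hasMajorant_ptcoS (μ : Fin (d + 1))
    (hU : ∀ w : SiteY i, ‖(UboxY i (cfg U₁) μ w : 𝔸)‖ ≤ 1 ∧ ‖(((UboxY i (cfg U₁) μ w)⁻¹ : 𝔸ˣ) : 𝔸)‖ ≤ 1) {K : g.Site → g.Site → ℝ}
    (hK : ∀ (z : SiteY i) (y' : g.Site), coordBound39 b * basisBound39 b *
      (|fdiffY i h μ z| * (if σ (shiftY i μ z) = y' then (1 : ℝ) else 0) + |fdiffY i h μ z| * (if σ z = y' then (1 : ℝ) else 0)) ≤ K (σ z) y') :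
    HasMajorant (g := g) (fun p : XSK κ i => σ p.1) (ptcoS i b B cfg U₁ h μ) (fun a y' => (etaS i * cR39 b)⁻¹ * K a y') := by
  unfold ptcoS
  refine hasMajorant_smul_nonneg _ (hasMajorant_coordOpK_of_kernel b σ _
    (fun z w => |fdiffY i h μ z| * (if shiftY i μ z = w then (1 : ℝ) else 0) + |fdiffY i h μ z| * (if z = w then (1 : ℝ) else 0))
    (fun _ z w a => (norm_ptKY_deltaY_le i (cfg U₁) h μ hU z w a).trans (le_of_eq (by ring))) (fun z w => by positivity) (fun z y' => ?_))
    (inv_nonneg.2 (mul_nonneg (etaS_pos i).le (cR39_nonneg b)))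
  rw [Finset.sum_add_distrib, sum_filter_mul_ite, sum_filter_mul_ite]; exact hK z y'

omit [DecidableEq κ] in
/-- ★★ **`P^L_□,μ` (`plcoS = −η⁻¹·(P_μ model)`) IS DOMINATED** with majorant `η⁻¹·K` under the `pcoS` kernel condition.
[cite: Balaban1985BackgroundPropagators, (3.88) p.409, (3.100) p.413; Balaban1984PropagatorsII, (2.51) p.232] -/
theorem hasMajorant_plcoS (μ : Fin (d + 1))
    (hU : ∀ w : SiteY i, ‖(UboxY i (cfg U₁) μ w : 𝔸)‖ ≤ 1 ∧ ‖(((UboxY i (cfg U₁) μ w)⁻¹ : 𝔸ˣ) : 𝔸)‖ ≤ 1) {K : g.Site → g.Site → ℝ}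
    (hK : ∀ (z : SiteY i) (y' : g.Site), coordBound39 b * basisBound39 b *
      (|fdiffY i h μ z| * (if σ z = y' then (1 : ℝ) else 0) + |bdiffY i h μ z| * (if σ ((shiftY i μ).symm z) = y' then (1 : ℝ) else 0)) ≤ K (σ z) y') :
    HasMajorant (g := g) (fun p : XSK κ i => σ p.1) (plcoS i b B cfg U₁ h μ) (fun a y' => (etaS i)⁻¹ * K a y') := by
  unfold plcoS
  refine hasMajorant_neg' _ (hasMajorant_smul_nonneg _ (hasMajorant_coordOpK_of_kernel b σ _
    (fun z w => |fdiffY i h μ z| * (if z = w then (1 : ℝ) else 0) + |bdiffY i h μ z| * (if (shiftY i μ).symm z = w then (1 : ℝ) else 0))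
    (fun _ z w a => norm_pKY_deltaY_le i (cfg U₁) h μ hU z w a) (fun z w => by positivity) (fun z y' => ?_)) (inv_nonneg.2 (etaS_pos i).le))
  rw [Finset.sum_add_distrib, sum_filter_mul_ite, sum_filter_mul_ite]; exact hK z y'

omit [DecidableEq κ] in
/-- ★★ **`C_□` (`ccoS`) IS DOMINATED**: `coordBound·basisBound·(|Δh z|·𝟙[σ z = y′] + Σ_{w : σ w = y′} |avgCoeffY z w|·|h z − h w|) ≤ K(σ z, y′)` ⟹ majorant `(η²·c_R)⁻¹·K`.
[cite: Balaban1985BackgroundPropagators, (3.88)–(3.89) p.409; Balaban1984PropagatorsII, (2.39)–(2.40) pp.229–230, (2.51) p.232] -/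
theorem hasMajorant_ccoS
    (hT : ∀ z w : SiteY i, ‖(avgTrY i parS (cfg U₁) z w : 𝔸)‖ ≤ 1 ∧ ‖(((avgTrY i parS (cfg U₁) z w)⁻¹ : 𝔸ˣ) : 𝔸)‖ ≤ 1) {K : g.Site → g.Site → ℝ}
    (hK : ∀ (z : SiteY i) (y' : g.Site), coordBound39 b * basisBound39 b *
      (|lapDiffY i h z| * (if σ z = y' then (1 : ℝ) else 0) + ∑ w ∈ Finset.univ.filter (fun w => σ w = y'), |avgCoeffY i z w| * |h z - h w|) ≤ K (σ z) y') :
    HasMajorant (g := g) (fun p : XSK κ i => σ p.1) (ccoS i b B cfg parS U₁ h) (fun a y' => (etaS i ^ 2 * cR39 b)⁻¹ * K a y') := by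
  unfold ccoS
  refine hasMajorant_smul_nonneg _ (hasMajorant_coordOpK_of_kernel b σ _
    (fun z w => |lapDiffY i h z| * (if z = w then (1 : ℝ) else 0) + |avgCoeffY i z w| * |h z - h w|)
    (fun _ z w a => norm_cKY_deltaY_le i parS (cfg U₁) h z (hT z) w a) (fun z w => by positivity) (fun z y' => ?_))
    (inv_nonneg.2 (mul_nonneg (pow_nonneg (etaS_pos i).le 2) (cR39_nonneg b)))
  rw [Finset.sum_add_distrib, sum_filter_mul_ite]; exact hK z y'

omit [DecidableEq κ] in
/-- ★★ **`Cᵗ_□` (`ctcoS`) IS DOMINATED** under the `ccoS` kernel condition, majorant `(η²·c_R)⁻¹·K`. [cite: Balaban1985BackgroundPropagators, (3.88)–(3.89) p.409; Balaban1984PropagatorsII, (2.51) p.232] -/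
theorem hasMajorant_ctcoS
    (hT : ∀ z w : SiteY i, ‖(avgTrY i parS (cfg U₁) z w : 𝔸)‖ ≤ 1 ∧ ‖(((avgTrY i parS (cfg U₁) z w)⁻¹ : 𝔸ˣ) : 𝔸)‖ ≤ 1) {K : g.Site → g.Site → ℝ}
    (hK : ∀ (z : SiteY i) (y' : g.Site), coordBound39 b * basisBound39 b *
      (|lapDiffY i h z| * (if σ z = y' then (1 : ℝ) else 0) + ∑ w ∈ Finset.univ.filter (fun w => σ w = y'), |avgCoeffY i z w| * |h z - h w|) ≤ K (σ z) y') :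
    HasMajorant (g := g) (fun p : XSK κ i => σ p.1) (ctcoS i b B cfg parS U₁ h) (fun a y' => (etaS i ^ 2 * cR39 b)⁻¹ * K a y') := by
  unfold ctcoS
  refine hasMajorant_smul_nonneg _ (hasMajorant_coordOpK_of_kernel b σ _
    (fun z w => |lapDiffY i h z| * (if z = w then (1 : ℝ) else 0) + |avgCoeffY i z w| * |h z - h w|)
    (fun _ z w a => norm_ctKY_deltaY_le i parS (cfg U₁) h z (hT z) w a) (fun z w => by positivity) (fun z y' => ?_))
    (inv_nonneg.2 (mul_nonneg (pow_nonneg (etaS_pos i).le 2) (cR39_nonneg b)))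
  rw [Finset.sum_add_distrib, sum_filter_mul_ite]; exact hK z y'

omit [CompleteSpace 𝔸] [DecidableEq κ] in
/-- ★★ **`C^L_□` (`clcoS = −η⁻²·M_{Δh}`) IS DOMINATED**: `coordBound·basisBound·|Δh z|·𝟙[σ z = y′] ≤ K(σ z, y′)` ⟹ majorant `η⁻²·K` (no transporter enters).
[cite: Balaban1985BackgroundPropagators, (3.88) p.409, (3.100) p.413; Balaban1984PropagatorsII, (2.51) p.232] -/
theorem hasMajorant_clcoS {K : g.Site → g.Site → ℝ}
    (hK : ∀ (z : SiteY i) (y' : g.Site), coordBound39 b * basisBound39 b * (|lapDiffY i h z| * (if σ z = y' then (1 : ℝ) else 0)) ≤ K (σ z) y') :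
    HasMajorant (g := g) (fun p : XSK κ i => σ p.1) (clcoS (𝔸 := 𝔸) i b h) (fun a y' => (etaS i ^ 2)⁻¹ * K a y') := by
  unfold clcoS
  refine hasMajorant_neg' _ (hasMajorant_smul_nonneg _ (hasMajorant_coordOpK_of_kernel b σ _
    (fun z w => |lapDiffY i h z| * (if z = w then (1 : ℝ) else 0))
    (fun _ z w a => norm_clLetter_deltaY_le i h z w a) (fun z w => by positivity) (fun z y' => ?_)) (inv_nonneg.2 (pow_nonneg (etaS_pos i).le 2)))
  rw [sum_filter_mul_ite]; exact hK z y'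

omit [DecidableEq κ] in
/-- ★★ **`C^D(U,h)` (`cdcoS`, slice `ν ↦ η⁻¹·M_{∂⁺_νh}∘S_ν`) IS DOMINATED**: `coordBound·basisBound·Σ_ν |∂⁺_νh z|·𝟙[σ(z + e_ν) = y′] ≤ K(σ z, y′)` ⟹ majorant `η⁻¹·K`
(the fibre kernel is summed over the directions so that one kernel serves every slice). [cite: Balaban1985BackgroundPropagators, (3.100) p.413; Balaban1984PropagatorsII, (2.51) p.232] -/
theorem hasMajorant_cdcoS
    (hU : ∀ (ν : Fin (d + 1)) (w : SiteY i), ‖(UboxY i (cfg U₁) ν w : 𝔸)‖ ≤ 1 ∧ ‖(((UboxY i (cfg U₁) ν w)⁻¹ : 𝔸ˣ) : 𝔸)‖ ≤ 1) {K : g.Site → g.Site → ℝ}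
    (hK : ∀ (z : SiteY i) (y' : g.Site), coordBound39 b * basisBound39 b *
      (∑ ν : Fin (d + 1), |fdiffY i h ν z| * (if σ (shiftY i ν z) = y' then (1 : ℝ) else 0)) ≤ K (σ z) y') :
    HasMajorant (g := g) (fun p : XSK κ i => σ p.1) (cdcoS i b B cfg U₁ h) (fun a y' => (etaS i)⁻¹ * K a y') := by
  unfold cdcoS
  refine hasMajorant_smul_nonneg _ (hasMajorant_coordOpK_of_kernel b σ _
    (fun z w => ∑ ν : Fin (d + 1), |fdiffY i h ν z| * (if shiftY i ν z = w then (1 : ℝ) else 0))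
    (fun ν z w a => ?_) (fun z w => Finset.sum_nonneg fun ν _ => by positivity) (fun z y' => ?_)) (inv_nonneg.2 (etaS_pos i).le)
  · refine (norm_cdLetter_deltaY_le i (cfg U₁) h ν (hU ν) z w a).trans (mul_le_mul_of_nonneg_right ?_ (norm_nonneg a))
    exact Finset.single_le_sum (f := fun ν' => |fdiffY i h ν' z| * (if shiftY i ν' z = w then (1 : ℝ) else 0)) (fun ν' _ => by positivity)
      (Finset.mem_univ ν)
  · rw [Finset.sum_comm]; simp_rw [sum_filter_mul_ite]; exact hK z y'

omit [DecidableEq κ] in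
/-- ★★ **`C^{Lt}(U,h)` (`cltcoS`, slice `ν ↦ η⁻¹·C^{Lt}_ν`) IS DOMINATED**: `coordBound·basisBound·Σ_ν |∂⁻̃_νh z|·𝟙[σ(z − e_ν) = y′] ≤ K(σ z, y′)` ⟹ majorant `η⁻¹·K`.
[cite: Balaban1985BackgroundPropagators, (3.100) p.413, (3.8) p.392; Balaban1984PropagatorsII, (2.51) p.232] -/
theorem hasMajorant_cltcoS
    (hU : ∀ (ν : Fin (d + 1)) (w : SiteY i), ‖(UboxY i (cfg U₁) ν w : 𝔸)‖ ≤ 1 ∧ ‖(((UboxY i (cfg U₁) ν w)⁻¹ : 𝔸ˣ) : 𝔸)‖ ≤ 1) {K : g.Site → g.Site → ℝ}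
    (hK : ∀ (z : SiteY i) (y' : g.Site), coordBound39 b * basisBound39 b *
      (∑ ν : Fin (d + 1), |bdiffY i h ν z| * (if σ ((shiftY i ν).symm z) = y' then (1 : ℝ) else 0)) ≤ K (σ z) y') :
    HasMajorant (g := g) (fun p : XSK κ i => σ p.1) (cltcoS i b B cfg U₁ h) (fun a y' => (etaS i)⁻¹ * K a y') := by
  unfold cltcoS
  refine hasMajorant_smul_nonneg _ (hasMajorant_coordOpK_of_kernel b σ _
    (fun z w => ∑ ν : Fin (d + 1), |bdiffY i h ν z| * (if (shiftY i ν).symm z = w then (1 : ℝ) else 0))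
    (fun ν z w a => ?_) (fun z w => Finset.sum_nonneg fun ν _ => by positivity) (fun z y' => ?_)) (inv_nonneg.2 (etaS_pos i).le)
  · refine (norm_cltY_deltaY_le i (cfg U₁) h ν (hU ν) z w a).trans (mul_le_mul_of_nonneg_right ?_ (norm_nonneg a))
    exact Finset.single_le_sum (f := fun ν' => |bdiffY i h ν' z| * (if (shiftY i ν').symm z = w then (1 : ℝ) else 0)) (fun ν' _ => by positivity)
      (Finset.mem_univ ν)
  · rw [Finset.sum_comm]; simp_rw [sum_filter_mul_ite]; exact hK z y'

end Dom

end Literature.MathematicalPhysics.QuantumFieldTheory.Balaban1983to89.B9WalkLettersCoordsDom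

end
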